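import Mathlib.Algebra.Algebra.Operations
import Mathlib.Algebra.Algebra.Subalgebra.Basic
import Mathlib.LinearAlgebra.Dimension.Finrank
import Mathlib.LinearAlgebra.FiniteDimensional.Defs
import HarnessLib

/-!
# Kneser's theorem for field extensions (Hou–Leung–Xiang; Bachoc–Serra–Zémor)

Topic `Literature/Combinatorics/Additive` (linear analogues of addition theorems: cardinalities of
subsets of an abelian group are replaced by dimensions of subspaces of a field extension, the
sumset `S + T` by the `F`-linear span `ST` of the products `st`).

* `mulStabilizer X` — the stabilizer `H(X) = {k ∈ L : kX ⊆ X}` of an `F`-subspace `X` of an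
  `F`-algebra `L`, bundled as a subalgebra (for `X ≠ 0` finite-dimensional inside a field it is
  the largest subfield `K` with `XK = X`).
* `LinearKneser` — the NAMED FACT (D-0014): X.-D. Hou, K. H. Leung, Q. Xiang, *A generalization
  of an addition theorem of Kneser*, J. Number Theory 97 (2002) 1–9, main theorem, in the form
  displayed by C. Bachoc, O. Serra, G. Zémor, *Revisiting Kneser's theorem for field extensions*,
  Combinatorica 38 (2018) 759–777 (arXiv:1510.01354, p. 2): "Let `F` be a field, `L/F` a field
  extension, and let `S` and `T` be `F`-subvectorspaces of `L` of finite dimension. [Suppose that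
  every algebraic element in `L` is separable over `F`.] Then one of the following holds:
  `dim ST ≥ dim S + dim T − 1`; there exists a subfield `K`, `F ⊊ K ⊂ L`, such that `STK = ST`",
  and "The conclusion of the Theorem of Hou et al. given in [hou2002] is that we have
  `dim ST ≥ dim S + dim T − dim H(ST)`, where `H(ST) = {x ∈ L : xST ⊂ ST}` denotes the stabilizer
  of `ST` in `L`. As is explained in [hou2002], the above formulation is easily seen to be
  equivalent to the conclusion of Theorem 2." Bachoc–Serra–Zémor's Theorem 3 (loc. cit.) removes
  the separability assumption ("we prove Hou's conjecture and remove the separability assumption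
  in Theorem 2"), so the fact is vendored WITHOUT it. We render the stabilizer form, for `S, T`
  nonzero (for `S = 0` the printed inequality is void: `ST = 0` is stabilised by all of `L`).

Not here: the dichotomy / one-sided form (BSZ 2018, Thm 3), the linear Cauchy–Davenport and
Vosper theorems (Bachoc–Serra–Zémor, Math. Proc. Cambridge Philos. Soc. 163 (2017), Thms 2, 3),
critical-pair (inverse) statements. Mathlib has the group-theoretic Kneser/Cauchy–Davenport
(`Mathlib/Combinatorics/Additive/`), not this linear analogue (`lean search Kneser`: no field
version, 2026-08-15).

Grounds `Summit.Schanuel.Schanuel.Theses.GridCapacity.KneserCapacityBound` (route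
Schanuel/GridCapacity: with `U = span X`, `V = span Y`, `UV ⊆ L = span x`, the stabilizer of `UV`
is a number field `K` with a line `K·w ⊆ L`, so `d + ℓ ≤ dim UV + [K:ℚ] ≤ n + h`).

## References
* [HouLeungXiang2002] X.-D. Hou, K. H. Leung, Q. Xiang, J. Number Theory 97 (2002) 1–9, main
  theorem (paywalled, acq-02422; quoted from BSZ 2018, Thm 2 and the display following it).
* [BachocSerraZemor2018Kneser] C. Bachoc, O. Serra, G. Zémor, Combinatorica 38 (2018) 759–777 =
  arXiv:1510.01354, Theorem 2 (statement of Hou–Leung–Xiang), the displayed stabilizer form, and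
  Theorem 3 (removal of separability), pp. 2–3.
* [BachocSerraZemor2017] C. Bachoc, O. Serra, G. Zémor, Math. Proc. Cambridge Philos. Soc. 163
  (2017) 423–452 = arXiv:1501.00602, Theorem 1 (the same statement, "Theorem 1 (Hou, Cheng and
  Xiang)", with `H(ST) = {x ∈ L : xST = ST}`).
-/

namespace Literature.Combinatorics.Additive

/-- The (multiplicative) **stabilizer** `H(X) = {k ∈ L : k·X ⊆ X}` of an `F`-subspace `X` of an
`F`-algebra `L`, as an `F`-subalgebra of `L` (closed under `+`, `*` and scalars because `X` is a
subspace). For a nonzero finite-dimensional `X` in a field extension `L/F` it is a subfield,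
finite-dimensional over `F` (`kX ⊆ X`, `k ≠ 0` forces `kX = X`), "the stabilizer of `ST` in `L`"
of the linear Kneser theorem. [cite: BachocSerraZemor2018Kneser, §1 (definition of H(ST)), p. 2] -/
def mulStabilizer {F L : Type*} [CommSemiring F] [Semiring L] [Algebra F L] (X : Submodule F L) :
    Subalgebra F L where
  carrier := {k | ∀ x ∈ X, k * x ∈ X}
  mul_mem' {a b} ha hb := fun x hx => by
    rw [mul_assoc]
    exact ha _ (hb x hx)
  one_mem' := fun x hx => by rwa [one_mul]
  add_mem' {a b} ha hb := fun x hx => by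
    rw [add_mul]
    exact X.add_mem (ha x hx) (hb x hx)
  zero_mem' := fun x _ => by
    rw [zero_mul]
    exact X.zero_mem
  algebraMap_mem' c := fun x hx => by
    rw [Algebra.algebraMap_eq_smul_one, smul_mul_assoc, one_mul]
    exact X.smul_mem c hx

/-- Membership in the stabilizer: `k ∈ H(X) ↔ ∀ x ∈ X, k x ∈ X`. [folklore] -/
theorem mem_mulStabilizer {F L : Type*} [CommSemiring F] [Semiring L] [Algebra F L]
    {X : Submodule F L} {k : L} : k ∈ mulStabilizer X ↔ ∀ x ∈ X, k * x ∈ X :=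
  Iff.rfl

/-- The stabilizer acts on `X`: `H(X) · X ≤ X` (as `F`-subspaces of `L`). [folklore] -/
theorem mulStabilizer_mul_le {F L : Type*} [CommSemiring F] [Semiring L] [Algebra F L]
    (X : Submodule F L) : Subalgebra.toSubmodule (mulStabilizer X) * X ≤ X := by
  rw [Submodule.mul_le]
  intro k hk x hx
  exact hk x hx

/-- **Kneser's theorem for field extensions** (Hou–Leung–Xiang 2002, main theorem; separability
assumption removed by Bachoc–Serra–Zémor 2018, Theorem 3), stabilizer form as displayed in
Bachoc–Serra–Zémor 2018, p. 2: for a field extension `L/F` and nonzero finite-dimensional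
`F`-subspaces `S, T ⊆ L`, with `ST` the `F`-span of the products and
`H(ST) = {x ∈ L : x·ST ⊆ ST}` its stabilizer,
`dim_F ST ≥ dim_F S + dim_F T − dim_F H(ST)`.
(Here `S * T` is Mathlib's product of submodules of an algebra, i.e. exactly the span of the
products; `H(ST)` is `mulStabilizer (S * T)`, a subfield of `L` finite over `F` since `ST ≠ 0`, so
`Module.finrank` takes no junk value. Stated for `F L : Type`.) Named fact, not in Mathlib; users
take `(h : LinearKneser)`.
[cite: BachocSerraZemor2018Kneser, Thm 2 and the display after it, Thm 3 (pp. 2–3)]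
[cite: HouLeungXiang2002, main theorem (as quoted in BachocSerraZemor2018Kneser Thm 2)] -/
def LinearKneser : Prop :=
  ∀ (F L : Type) [Field F] [Field L] [Algebra F L] (S T : Submodule F L),
    FiniteDimensional F S → FiniteDimensional F T → S ≠ ⊥ → T ≠ ⊥ →
      Module.finrank F S + Module.finrank F T ≤
        Module.finrank F ↥(S * T) + Module.finrank F ↥(mulStabilizer (S * T))

end Literature.Combinatorics.Additive
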